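import Summits.AtomisticToContinuum.HydrodynamicLimit.Theorems.BoltzmannGreenKubo.Negative.Dephasing

/-!
# `BoltzmannGreenKubo` with `N₀` UNIFORM IN THE MODULATION `φ` is FALSE — free-streaming dephasing

Negative knowledge for the crux `AntiMazurCoboundaries.BoltzmannGreenKubo` (stmt-AtomisticToContinuum-13985), from the
standing disprover's `Cruxes/BoltzmannGreenKubo/Disproof.lean` §2c (gen 2): `BoltzmannGreenKuboUniformPhi` is the crux
VERBATIM except that the binders `∀ φ, Continuous φ → (∀ x, |φ x| ≤ 1) →` are moved INSIDE, after `∃ N₀ ∀ N ≥ N₀` (so the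
particle-number threshold may not depend on the spatial test function). It is FALSE: at fixed `N, σ, h, Φ` the modulations
`φ_k(x) = cos(2πk x₀)` (`∫φ_k² = 1/2`) make the kinetic-window functional tend to `0` as `k → ∞` (`tendsto_window_obsK`:
the deterministic dephasing of `Negative/Dephasing.lean`; velocities with `v₀ = 0` are `G_N`-null at every fixed time by
stationarity and the Gaussian marginal, hence at all rational times, hence at ALL times by right free flight —
`ae_vel_ne_zero`; dominated convergence in `z`), while the Boltzmann side stays `2·(1/2)·D(g_B) = D(g_B) > 0`
(`Negative/ForallN`). Hence THE `φ`-DEPENDENCE OF `N₀` IS LOAD-BEARING: any proof must separate the scale of `φ` from the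
mean free path `ℓ/σ²` quantitatively (transport dephasing is real below it); no comparison statement can be a black box
in `φ` (the kernel-checked form of the triagers' objection to `GreenKuboAlongBoltzmannGradFamilies` as typed, TRIAGE-r1).
refuter-cdisprove-stmt-AtomisticToContinuum-13985-g2-0.
-/

noncomputable section

namespace Summit.AtomisticToContinuum.HydrodynamicLimit.Theorems

open MeasureTheory ProbabilityTheory Filter Topology Set
open Literature.Analysis.FluidPDE Literature.MathematicalPhysics.KineticTheory
open Literature.Analysis.UnboundedOperators
open scoped InnerProductSpace
open BoltzmannGreenKuboForallN BoltzmannGreenKuboOrthMomentum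

namespace BoltzmannGreenKuboUniformPhi

/-! ### Dynamics under the Gibbs law: non-vanishing velocities, dominated convergence -/

section Dynamics

variable {σ : ℝ} {N : ℕ}

/-- The first velocity coordinate is measurable. [folklore] -/
theorem measurable_coord_zero : Measurable fun w : V3 => w 0 := (measurePreserving_coord 0).measurable

/-- At each FIXED time, a.s. no particle has vanishing first velocity component (stationarity + Gaussian
marginal, which has no atoms). [folklore] -/
theorem ae_vel_ne_zero_at (hσ : σ ≤ 1 / 2)
    (Φ : HardSphereFlow (Torus.geometry (Fin 3)) (hsDiameter σ N) (N + 1)) (t : ℝ) :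
    ∀ᵐ z ∂(localGibbsLaw σ (fun _ => 1) (fun _ => 0) (fun _ => 1) N Φ), ∀ i, (Φ.flow t z i).2 0 ≠ 0 := by
  set G := localGibbsLaw σ (fun _ => (1 : ℝ)) (fun _ => (0 : V3)) (fun _ => (1 : ℝ)) N Φ with hGdef
  rw [ae_all_iff]
  intro i
  have hSm : MeasurableSet {w : Config (N + 1) (Fin 3) T3 | (w i).2 0 = 0} :=
    measurableSet_eq_fun (measurable_coord_zero.comp (measurable_pi_apply i).snd) measurable_const
  have hS0 : G {w | (w i).2 0 = 0} = 0 := by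
    have hBm : MeasurableSet {v : Fin (N + 1) → V3 | v i 0 = 0} :=
      measurableSet_eq_fun (measurable_coord_zero.comp (measurable_pi_apply i)) measurable_const
    have h1 : G {w | (w i).2 0 = 0} = (G.map velOf) {v : Fin (N + 1) → V3 | v i 0 = 0} := by
      rw [Measure.map_apply measurable_velOf hBm]
      rfl
    rw [h1, hGdef, map_velOf_localGibbsLaw hσ N Φ]
    have hVm : MeasurableSet {w : V3 | w 0 = 0} := measurableSet_eq_fun measurable_coord_zero measurable_const
    have h2 := (MeasureTheory.measurePreserving_eval (μ := fun _ : Fin (N + 1) => stdGaussian V3) i).measure_preimage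
      hVm.nullMeasurableSet
    have h3 := (measurePreserving_coord 0).measure_preimage
      ((measurableSet_singleton (0 : ℝ)).nullMeasurableSet (μ := gaussianReal 0 1))
    haveI := nullSingletonClass_gaussianReal (μ := (0 : ℝ)) (v := 1) one_ne_zero
    rw [measure_singleton] at h3
    simp only [Set.preimage, Set.mem_singleton_iff] at h3
    rw [← h3]
    simp only [Set.preimage, Function.eval, Set.mem_setOf_eq] at h2
    exact h2
  have hpre : G ((Φ.flow t) ⁻¹' {w | (w i).2 0 = 0}) = 0 := by
    rw [(measurePreserving_flow_localGibbsLaw 1 1 0 Φ t).measure_preimage hSm.nullMeasurableSet, hS0]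
  rw [ae_iff]
  simpa [Set.preimage] using hpre

/-- **A.s. no particle EVER has vanishing first velocity component** (all rational times by countability, all
times by right free flight: velocities are right-continuous step functions). [folklore] -/
theorem ae_vel_ne_zero (hσ : σ ≤ 1 / 2)
    (Φ : HardSphereFlow (Torus.geometry (Fin 3)) (hsDiameter σ N) (N + 1)) :
    ∀ᵐ z ∂(localGibbsLaw σ (fun _ => 1) (fun _ => 0) (fun _ => 1) N Φ),
      z ∈ Φ.good ∧ ∀ (r : ℝ) (i : Fin (N + 1)), (Φ.flow r z i).2 0 ≠ 0 := by
  have h1 : ∀ᵐ z ∂(localGibbsLaw σ (fun _ => 1) (fun _ => 0) (fun _ => 1) N Φ),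
      ∀ q : ℚ, ∀ i, (Φ.flow (q : ℝ) z i).2 0 ≠ 0 := by
    rw [ae_all_iff]
    intro q
    exact ae_vel_ne_zero_at hσ Φ q
  filter_upwards [ae_mem_good_localGibbsLaw' 1 1 0 Φ, h1] with z hz hq
  refine ⟨hz, fun r i => ?_⟩
  obtain ⟨δ, hδ, hfree⟩ := exists_freeFlight_right (Φ.isTrajectory z hz) r
  obtain ⟨q, hq1, hq2⟩ := exists_rat_btwn (show r < r + δ by linarith)
  have hflight := hfree q ⟨hq1.le, hq2.le⟩
  have hvel : (Φ.flow (q : ℝ) z i).2 = (Φ.flow r z i).2 := by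
    rw [hflight, freeFlight_apply]
  rw [← hvel]
  exact hq q i

/-- Good orbits are measurable in time (sections of the jointly measurable modified flow). [folklore] -/
theorem measurable_orbit (Φ : HardSphereFlow (Torus.geometry (Fin 3)) (hsDiameter σ N) (N + 1))
    {z : Config (N + 1) (Fin 3) T3} (hz : z ∈ Φ.good) : Measurable fun r : ℝ => Φ.flow r z := by
  have h : (fun r : ℝ => Φ.flow r z) = fun r => flowMod Φ (r, z) :=
    funext fun r => (flowMod_of_mem Φ hz).symm
  rw [h]
  exact (measurable_flowMod Φ).comp (measurable_id.prodMk measurable_const)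

/-- The modulated observables are uniformly bounded and integrable. [folklore] -/
theorem integrable_obsK (Φ : HardSphereFlow (Torus.geometry (Fin 3)) (hsDiameter σ N) (N + 1))
    [IsProbabilityMeasure (localGibbsLaw σ (fun _ => 1) (fun _ => 0) (fun _ => 1) N Φ)]
    (k : ℕ) {g : V3 → ℝ} (hg : Continuous g) {K : ℝ} (hgb : ∀ v, |g v| ≤ K) :
    Integrable (obsK (n := N + 1) k g) (localGibbsLaw σ (fun _ => 1) (fun _ => 0) (fun _ => 1) N Φ) := by
  refine (integrable_const (((N + 1 : ℕ) : ℝ) * K)).mono' (continuous_obsK k hg).measurable.aestronglyMeasurable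
    (Eventually.of_forall fun w => ?_)
  rw [Real.norm_eq_abs]
  exact abs_obsK_le k hgb w

/-- **DEPHASING OF THE KINETIC-WINDOW FUNCTIONAL**: at fixed `N`, `σ ≤ 1/2`, `h > 0` and flow `Φ`, the window functional
`E_{G_N}[(h⁻¹∫₀ʰ Σᵢ cos(2πk xᵢ₀(r)) g(vᵢ(r)) dr)²]` of the modulated observable tends to `0` as `k → ∞`
(dominated convergence; pointwise by `tendsto_integral_obsK` on the full-measure set of `ae_vel_ne_zero`). [folklore] -/
theorem tendsto_window_obsK (hσ : σ ≤ 1 / 2)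
    (Φ : HardSphereFlow (Torus.geometry (Fin 3)) (hsDiameter σ N) (N + 1))
    [IsProbabilityMeasure (localGibbsLaw σ (fun _ => 1) (fun _ => 0) (fun _ => 1) N Φ)]
    {g : V3 → ℝ} (hg : Continuous g) {K : ℝ} (hgb : ∀ v, |g v| ≤ K) {h : ℝ} (hh : 0 < h) :
    Tendsto (fun k : ℕ => ∫ z, (h⁻¹ * ∫ r in (0 : ℝ)..h, obsK k g (Φ.flow r z)) ^ 2
      ∂(localGibbsLaw σ (fun _ => 1) (fun _ => 0) (fun _ => 1) N Φ)) atTop (𝓝 0) := by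
  set G := localGibbsLaw σ (fun _ => (1 : ℝ)) (fun _ => (0 : V3)) (fun _ => (1 : ℝ)) N Φ with hGdef
  set B : ℝ := ((N + 1 : ℕ) : ℝ) * K with hB
  have hmeas : ∀ k : ℕ, AEStronglyMeasurable
      (fun z => (h⁻¹ * ∫ r in (0 : ℝ)..h, obsK k g (Φ.flow r z)) ^ 2) G := fun k =>
    ((integrable_window 1 1 0 Φ (continuous_obsK k hg).measurable (integrable_obsK Φ k hg hgb)
      hh.le).aestronglyMeasurable.const_mul _).pow 2
  have hbound : ∀ k : ℕ, ∀ᵐ z ∂G, ‖(h⁻¹ * ∫ r in (0 : ℝ)..h, obsK k g (Φ.flow r z)) ^ 2‖ ≤ B ^ 2 := by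
    intro k
    refine Eventually.of_forall fun z => ?_
    have hI : ‖∫ r in (0 : ℝ)..h, obsK k g (Φ.flow r z)‖ ≤ B * |h - 0| :=
      intervalIntegral.norm_integral_le_of_norm_le_const fun r _ => by
        rw [Real.norm_eq_abs]; exact abs_obsK_le k hgb _
    rw [sub_zero, abs_of_pos hh, Real.norm_eq_abs] at hI
    have hA : |h⁻¹ * ∫ r in (0 : ℝ)..h, obsK k g (Φ.flow r z)| ≤ B := by
      rw [abs_mul, abs_inv, abs_of_pos hh]
      calc h⁻¹ * |∫ r in (0 : ℝ)..h, obsK k g (Φ.flow r z)| ≤ h⁻¹ * (B * h) :=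
            mul_le_mul_of_nonneg_left hI (inv_nonneg.2 hh.le)
        _ = B := by field_simp
    rw [Real.norm_eq_abs, abs_pow, ← sq_abs B]
    have hB0 : 0 ≤ B := (abs_nonneg _).trans hA
    rw [sq_abs B]
    exact pow_le_pow_left₀ (abs_nonneg _) hA 2
  have hlim : ∀ᵐ z ∂G, Tendsto (fun k : ℕ => (h⁻¹ * ∫ r in (0 : ℝ)..h, obsK k g (Φ.flow r z)) ^ 2)
      atTop (𝓝 0) := by
    filter_upwards [ae_vel_ne_zero hσ Φ] with z hz
    have hT := tendsto_integral_obsK (Φ.isTrajectory z hz.1) (measurable_orbit Φ hz.1)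
      (fun r i => hz.2 r i) hg hgb _ hh.le le_rfl
    have := (hT.const_mul h⁻¹).pow 2
    simpa using this
  have := tendsto_integral_of_dominated_convergence (fun _ => B ^ 2) hmeas (integrable_const _) hbound hlim
  simpa using this

end Dynamics

end BoltzmannGreenKuboUniformPhi

open BoltzmannGreenKuboUniformPhi

/-! ### The strengthening and its refutation -/

/-- `BoltzmannGreenKubo` with the binders `∀ φ, Continuous φ → (∀ x, |φ x| ≤ 1) →` moved inside, AFTER
`∃ N₀ ∀ N ≥ N₀` (the particle-number threshold uniform in the spatial modulation); all else verbatim. -/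
def BoltzmannGreenKuboUniformPhi : Prop :=
  ∀ (a θ : ℝ) (u₀ : Literature.MathematicalPhysics.KineticTheory.V3), 0 < a → 0 < θ → ∀ (g : Literature.MathematicalPhysics.KineticTheory.V3 → ℝ), Continuous g → (∃ K : ℝ, ∀ v, |g v| ≤ K) → (∀ (c₀ c₂ : ℝ) (b : Literature.MathematicalPhysics.KineticTheory.V3), ∫ v, g v * (c₀ + inner ℝ b v + c₂ * ‖v‖ ^ 2) ∂(ProbabilityTheory.stdGaussian Literature.MathematicalPhysics.KineticTheory.V3) = 0) → ∀ η : ℝ, 0 < η → ∃ s₀ : ℝ, 0 < s₀ ∧ ∀ s : ℝ, s₀ ≤ s → ∃ σ₀ : ℝ, 0 < σ₀ ∧ ∀ σ : ℝ, 0 < σ → σ < σ₀ → (∀ (N : ℕ) (Φ : Literature.Analysis.FluidPDE.HardSphereFlow (Literature.Analysis.FluidPDE.Torus.geometry (Fin 3)) (Literature.MathematicalPhysics.KineticTheory.hsDiameter σ N) (N + 1)), MeasureTheory.IsProbabilityMeasure (Literature.MathematicalPhysics.KineticTheory.localGibbsLaw σ (fun _ => a) (fun _ => u₀) (fun _ =>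 θ) N Φ)) ∧ ∃ N₀ : ℕ, ∀ N : ℕ, N₀ ≤ N → ∀ (φ : Literature.MathematicalPhysics.KineticTheory.T3 → ℝ), Continuous φ → (∀ x, |φ x| ≤ 1) → ∀ Φ : Literature.Analysis.FluidPDE.HardSphereFlow (Literature.Analysis.FluidPDE.Torus.geometry (Fin 3)) (Literature.MathematicalPhysics.KineticTheory.hsDiameter σ N) (N + 1), (let h : ℝ := s / (σ ^ 2 * Real.sqrt θ) * ((N + 1 : ℕ) : ℝ) ^ (-(1 / 3 : ℝ)); |s * ((∫⁻ z, ENNReal.ofReal ((h⁻¹ * ∫ r in (0 : ℝ)..h, ∑ i, φ (Φ.flow r z i).1 * g ((Real.sqrt θ)⁻¹ • ((Φ.flow r z i).2 - u₀))) ^ 2) ∂(Literature.MathematicalPhysics.KineticTheory.localGibbsLaw σ (fun _ => a) (fun _ => u₀) (fun _ => θ) N Φ)).toReal / (((N : ℝ)) + 1)) - 2 * (∫ x, φ x ^ 2) * Literature.Analysis.UnboundedOperators.dirichletFormInv (Literature.Analysis.UnboundedOperators.hardSphereLinearizedOp (E := Literature.MathematicalPhysics.KineticTheory.V3)) g| ≤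 η)

/-- **`N₀` CANNOT BE CHOSEN UNIFORMLY IN THE MODULATION `φ` (free-streaming dephasing).** With `a = θ = 1`, `u₀ = 0`,
`g = g_B` (`D = dirichletFormInv L g_B > 0`), `η = D/2`, `s = s₀`, `σ = min(σ₀/2, 1/4)`, `N = N₀` and an Alexander flow,
the strengthening demands `|s₀·W_k/(N₀+1) − D| ≤ D/2` for every `φ_k = cos(2πk x₀)` (`∫φ_k² = 1/2`), i.e.
`s₀ W_k/(N₀+1) ≥ D/2` for all `k ≥ 1`; but `W_k → 0` (`tendsto_window_obsK`). Refutes the strengthening; the crux itself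
(φ fixed BEFORE `N → ∞`, hence macroscopic against the mean free path `ℓ/σ² → 0`) is untouched. [folklore] -/
theorem not_boltzmannGreenKuboUniformPhi : ¬ BoltzmannGreenKuboUniformPhi := by
  intro hyp
  have hD := dirichletFormInv_gB_pos
  set D := dirichletFormInv (hardSphereLinearizedOp (E := V3)) gB with hDdef
  obtain ⟨s₀, hs₀, h2⟩ := hyp 1 1 0 one_pos one_pos gB continuous_gB ⟨1, abs_gB_le⟩ gB_orth (D / 2) (by positivity)
  obtain ⟨σ₀, hσ₀, h3⟩ := h2 s₀ le_rfl
  set σ : ℝ := min (σ₀ / 2) (1 / 4) with hσdef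
  have hσpos : 0 < σ := lt_min (by linarith) (by norm_num)
  have hσlt : σ < σ₀ := lt_of_le_of_lt (min_le_left _ _) (by linarith)
  have hσle : σ ≤ 1 / 4 := min_le_right _ _
  have hσhalf : σ ≤ 1 / 2 := by linarith
  obtain ⟨hprob, N₀, h4⟩ := h3 σ hσpos hσlt
  have hεpos : 0 < hsDiameter σ N₀ := hsDiameter_pos hσpos N₀
  have hεlt : hsDiameter σ N₀ < 2⁻¹ := by
    have := hsDiameter_le hσpos.le N₀
    linarith
  obtain ⟨Φ⟩ := HardSphereFlow.nonempty_torus_holds (d := Fin 3) hεpos hεlt (N₀ + 1)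
  haveI := hprob N₀ Φ
  set hN : ℝ := s₀ / (σ ^ 2 * Real.sqrt 1) * ((N₀ + 1 : ℕ) : ℝ) ^ (-(1 / 3 : ℝ)) with hhN
  have hh : 0 < hN := by positivity
  set G := localGibbsLaw σ (fun _ => (1 : ℝ)) (fun _ => (0 : V3)) (fun _ => (1 : ℝ)) N₀ Φ with hGdef
  set W : ℕ → ℝ := fun k => ∫ z, (hN⁻¹ * ∫ r in (0 : ℝ)..hN, obsK k gB (Φ.flow r z)) ^ 2 ∂G with hWdef
  have hAm : ∀ k : ℕ, AEStronglyMeasurable (fun z => (hN⁻¹ * ∫ r in (0 : ℝ)..hN, obsK k gB (Φ.flow r z)) ^ 2) G :=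
    fun k => ((integrable_window 1 1 0 Φ (continuous_obsK k continuous_gB).measurable
      (integrable_obsK Φ k continuous_gB abs_gB_le) hh.le).aestronglyMeasurable.const_mul _).pow 2
  -- (1) the strengthening forces a floor `D/2 ≤ s₀ W_k/(N₀+1)` for every `k ≥ 1`
  have hfloor : ∀ k : ℕ, 1 ≤ k → D / 2 ≤ s₀ * (W k / ((N₀ : ℝ) + 1)) := by
    intro k hk
    have key := h4 N₀ le_rfl (fun x => cosK k (x 0)) ((continuous_cosK k).comp (continuous_apply 0))
      (fun x => abs_cosK_le k (x 0)) Φ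
    dsimp only at key
    rw [← hhN] at key
    simp only [Real.sqrt_one, inv_one, one_smul, sub_zero] at key
    rw [integral_cosK_sq_torus k hk] at key
    have hW : (∫⁻ z, ENNReal.ofReal ((hN⁻¹ * ∫ r in (0 : ℝ)..hN, obsK k gB (Φ.flow r z)) ^ 2) ∂G).toReal = W k := by
      simp only [hWdef]
      rw [integral_eq_lintegral_of_nonneg_ae (Eventually.of_forall fun z => sq_nonneg _) (hAm k)]
    change |s₀ * ((∫⁻ z, ENNReal.ofReal ((hN⁻¹ * ∫ r in (0 : ℝ)..hN, obsK k gB (Φ.flow r z)) ^ 2) ∂G).toReal /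
      ((N₀ : ℝ) + 1)) - 2 * (1 / 2) * D| ≤ D / 2 at key
    rw [hW, abs_le] at key
    linarith [key.1]
  -- (2) dephasing: `W_k → 0`
  have hlim : Tendsto W atTop (𝓝 0) := tendsto_window_obsK hσhalf Φ continuous_gB abs_gB_le hh
  have hlim' : Tendsto (fun k => s₀ * (W k / ((N₀ : ℝ) + 1))) atTop (𝓝 0) := by
    have := (hlim.div_const ((N₀ : ℝ) + 1)).const_mul s₀
    simpa using this
  -- (3) contradiction
  obtain ⟨k, hk1, hk2⟩ := ((eventually_ge_atTop 1).and (hlim'.eventually_lt_const (half_pos hD))).exists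
  exact absurd (hfloor k hk1) (not_le.2 hk2)

end Summit.AtomisticToContinuum.HydrodynamicLimit.Theorems

end
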